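import Mathlib
import HarnessLib
import Summits.ValiantsHypothesis.ValiantsHypothesis.Theorems.LacunarySymmetroidMatrixDescartesProductPlusOneLetterVariance

/-!
# ValiantsHypothesis / LacunarySymmetroid — crux `MatrixDescartes` (stmt-ValiantsHypothesis-18050, V1),
# LINE (A) «product_plus_one», floor: SIGN-FREE type-β windows at EVERY K and EVERY coupling from a letter-sign pattern

Sequel of ✓ `…LetterVariance` (val-idea-25 g3 AB6).  At a zero `t` of `R = eulerNumerator d a l₀` off the poles the reduced second moment with
`κ = d_{l₁} − d_{l₀}` (ANY pivot letter `l₁ ≠ l₀`) is `Σ_l (d_l − d_{l₀})(d_l − d_{l₁})·t^{d_l}·A_l(t)`, `A_l(t) = Σ_j a_{jl}/f_j(t)`; for a strictly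
increasing support the INDEX FACTOR `(d_l − d_{l₀})(d_l − d_{l₁})` is NEGATIVE exactly for the letters strictly between `l₀` and `l₁`, POSITIVE
exactly for the letters outside the index interval they span, and ZERO at `l₀`, `l₁`.  Hence:

* `indexFactor_neg_of_between`, `indexFactor_pos_of_outside` — the sign of the index factor;
* `eulerNumerator_roots_Icc_le_one_of_indexFactor_sign` — product form (signed weights `≤ 0`, one `< 0` at every zero ⇒ at most one zero);
* ★★ `eulerNumerator_roots_Icc_le_one_of_letterSigns` — EVERY K, EVERY COUPLING, NO row-sign hypothesis: `A_l ≥ 0` strictly between `l₀` and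
  `l₁`, `A_l ≤ 0` outside, one of them strict on the window ⇒ `R` has at most one zero on the pole-free window.  Its K = 3 instances are the six
  ✓ charts of `…ABWindow` / `…ABWindowMiddle` / `…ABWindowTop` (sign-free: ✓ `…ABWindowSignfree`), its every-K bottom instances the two ✓ charts of
  `…ABWindowK`; every-K TOP and MIDDLE couplings are new;
* ★ `eulerNumerator_roots_Icc_le_one_of_letterSigns_adjacent` — pivot adjacent to the coupling letter: all other letter sums `≤ 0`, one `< 0`;
* ★ `eulerNumeratorTopK_roots_Icc_le_one_of_middle_letterSums_nonneg` — every `K ≥ 3`, TOP coupling, pivot `0`: middle letter sums `≥ 0`, one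
  `> 0` (the top mirror of ✓ `eulerNumeratorK_roots_Icc_le_one_of_letterSums_pos`, for every company).
* `reducedMoment_zero_le_centredMoment_at_root`, ★ `eulerNumerator_roots_Icc_le_one_of_centredMoment_neg` — VARIANCE WINDOWS (AB6-1 as a count,
  every coupling at once): a negative centred moment `Σ_l (d_l − c)²·t^{d_l}·A_l(t)` at every zero ⇒ at most one zero, for every `l₀`.

HONEST FRAMING: located counting lemmas on type-β windows (the riser budget AB4 / the EB2 family are untouched); NOT `OneChangeFloorK3`, not
`stub_classRowK3`, not `stub_eulerBoundK3`, not `stub_polyLaw`, not `MatrixDescartes`, not Conjecture B; `VP ≠ VNP` is NOT proved.  No definitions,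
no named facts; Mathlib + ✓ `…LetterVariance` only.
-/

set_option linter.dupNamespace false

namespace Summit.ValiantsHypothesis.ValiantsHypothesis.Theorems.LacunarySymmetroidMatrixDescartes

namespace ProductPlusOne

open Polynomial Finset
open scoped BigOperators

/-! ### §1 The sign of the index factor `(d_l − d_{l₀})(d_l − d_{l₁})` for a strictly increasing support -/

/-- Strictly BETWEEN the coupling letter `l₀` and the pivot letter `l₁` the index factor is negative. [folklore] -/
theorem indexFactor_neg_of_between {K : ℕ} (d : Fin K → ℕ) (hd : StrictMono d) {l₀ l₁ l : Fin K}
    (h : (l₀ < l ∧ l < l₁) ∨ (l₁ < l ∧ l < l₀)) : ((d l : ℝ) - d l₀) * ((d l : ℝ) - d l₁) < 0 := by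
  rcases h with ⟨h0, h1⟩ | ⟨h1, h0⟩
  · have e0 : (d l₀ : ℝ) < d l := by exact_mod_cast hd h0
    have e1 : (d l : ℝ) < d l₁ := by exact_mod_cast hd h1
    exact mul_neg_of_pos_of_neg (sub_pos.mpr e0) (sub_neg.mpr e1)
  · have e0 : (d l : ℝ) < d l₀ := by exact_mod_cast hd h0
    have e1 : (d l₁ : ℝ) < d l := by exact_mod_cast hd h1
    exact mul_neg_of_neg_of_pos (sub_neg.mpr e0) (sub_pos.mpr e1)

/-- OUTSIDE the closed index interval spanned by `l₀` and `l₁` the index factor is positive. [folklore] -/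
theorem indexFactor_pos_of_outside {K : ℕ} (d : Fin K → ℕ) (hd : StrictMono d) {l₀ l₁ l : Fin K}
    (h : (l < l₀ ∧ l < l₁) ∨ (l₀ < l ∧ l₁ < l)) : 0 < ((d l : ℝ) - d l₀) * ((d l : ℝ) - d l₁) := by
  rcases h with ⟨h0, h1⟩ | ⟨h0, h1⟩
  · have e0 : (d l : ℝ) < d l₀ := by exact_mod_cast hd h0
    have e1 : (d l : ℝ) < d l₁ := by exact_mod_cast hd h1
    exact mul_pos_of_neg_of_neg (sub_neg.mpr e0) (sub_neg.mpr e1)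
  · have e0 : (d l₀ : ℝ) < d l := by exact_mod_cast hd h0
    have e1 : (d l₁ : ℝ) < d l := by exact_mod_cast hd h1
    exact mul_pos (sub_pos.mpr e0) (sub_pos.mpr e1)

/-! ### §2 Every K, every coupling: the sign-free type-β window count from a LETTER-SIGN PATTERN -/

/-- **Product form** (every format, every coupling `l₀`, every pivot letter `l₁`): on a pole-free `[u,v] ⊂ (0,∞)` on which every letter's
signed weight `(d_l − d_{l₀})(d_l − d_{l₁})·A_l(t)` is `≤ 0`, and at every zero of `R` one of them is `< 0`, `R = eulerNumerator d a l₀` has AT MOST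
ONE zero (✓ `eulerNumerator_roots_Icc_le_one_of_reducedMoment_neg` with `κ = d_{l₁} − d_{l₀}`; `A_l(t) = Σ_j a_{jl}/f_j(t)`). [this file's theorem] -/
theorem eulerNumerator_roots_Icc_le_one_of_indexFactor_sign {m K : ℕ} (d : Fin K → ℕ) (a : Fin m → Fin K → ℝ) (l₀ l₁ : Fin K)
    {u v : ℝ} (hu : 0 < u) (hf : ∀ t ∈ Set.Icc u v, ∀ j, (∑ l, C (a j l) * X ^ (d l) : ℝ[X]).eval t ≠ 0)
    (hle : ∀ t ∈ Set.Icc u v, ∀ l,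
      ((d l : ℝ) - d l₀) * ((d l : ℝ) - d l₁) * ∑ j, a j l / (∑ l', C (a j l') * X ^ (d l') : ℝ[X]).eval t ≤ 0)
    (hlt : ∀ t ∈ Set.Icc u v,
      (∑ j, (∑ l, C (a j l * ((d l : ℝ) - d l₀)) * X ^ (d l)) * ∏ i ∈ Finset.univ.erase j, (∑ l, C (a i l) * X ^ (d l))
          : ℝ[X]).eval t = 0 →
        ∃ l, ((d l : ℝ) - d l₀) * ((d l : ℝ) - d l₁) * ∑ j, a j l / (∑ l', C (a j l') * X ^ (d l') : ℝ[X]).eval t < 0) :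
    ((∑ j, (∑ l, C (a j l * ((d l : ℝ) - d l₀)) * X ^ (d l)) * ∏ i ∈ Finset.univ.erase j, (∑ l, C (a i l) * X ^ (d l))
        : ℝ[X]).roots.toFinset.filter (fun t => u ≤ t ∧ t ≤ v)).card ≤ 1 := by
  refine eulerNumerator_roots_Icc_le_one_of_reducedMoment_neg d a l₀ hu hf fun t ht hRt => ⟨(d l₁ : ℝ) - d l₀, ?_⟩
  have ht0 : 0 < t := hu.trans_le ht.1
  obtain ⟨lneg, hlneg⟩ := hlt t ht hRt
  have hterm : ∀ l, ((d l : ℝ) - d l₀) * (((d l : ℝ) - d l₀) - ((d l₁ : ℝ) - d l₀)) * t ^ (d l)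
        * ∑ j, a j l / (∑ l', C (a j l') * X ^ (d l') : ℝ[X]).eval t
      = t ^ (d l) * (((d l : ℝ) - d l₀) * ((d l : ℝ) - d l₁) * ∑ j, a j l / (∑ l', C (a j l') * X ^ (d l') : ℝ[X]).eval t) :=
    fun l => by ring
  simp only [hterm]
  calc ∑ l, t ^ (d l) * (((d l : ℝ) - d l₀) * ((d l : ℝ) - d l₁) * ∑ j, a j l / (∑ l', C (a j l') * X ^ (d l') : ℝ[X]).eval t)
      < ∑ _l : Fin K, (0 : ℝ) :=
        Finset.sum_lt_sum (fun l _ => mul_nonpos_of_nonneg_of_nonpos (pow_nonneg ht0.le _) (hle t ht l))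
          ⟨lneg, Finset.mem_univ _, mul_neg_of_pos_of_neg (pow_pos ht0 _) hlneg⟩
    _ = 0 := Finset.sum_const_zero

/-- ★★ **SIGN-FREE TYPE-β WINDOWS, EVERY K, EVERY COUPLING** (strictly increasing support; no row-sign hypothesis): fix the coupling letter `l₀`
and ANY pivot letter `l₁ ≠ l₀`.  If on a pole-free `[u,v] ⊂ (0,∞)` the letter sums `A_l = Σ_j a_{jl}/f_j` satisfy
`A_l ≥ 0` for the letters STRICTLY BETWEEN `l₀` and `l₁`, `A_l ≤ 0` for the letters OUTSIDE the index interval they span, and ONE of these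
inequalities is strict throughout the window, then `R = eulerNumerator d a l₀` has AT MOST ONE zero in `[u,v]`.
(K = 3: bottom `l₁ = 2` ↦ `A₁ > 0`, `l₁ = 1` ↦ `A₂ < 0`; middle `l₁ = 0` ↦ `A₂ < 0`, `l₁ = 2` ↦ `A₀ < 0`; top `l₁ = 0` ↦ `A₁ > 0`, `l₁ = 1` ↦ `A₀ < 0`
— the six ✓ charts; every K bottom: `l₁ = K−1` ↦ middle sums `≥ 0`, `l₁ = 1` ↦ upper sums `≤ 0` — ✓ `…ABWindowK`; every K TOP and MIDDLE couplings
are new.) [this file's theorem; val-idea-25 AB6-2, every coupling] -/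
theorem eulerNumerator_roots_Icc_le_one_of_letterSigns {m K : ℕ} (d : Fin K → ℕ) (hd : StrictMono d) (a : Fin m → Fin K → ℝ)
    (l₀ l₁ : Fin K) {u v : ℝ} (hu : 0 < u) (hf : ∀ t ∈ Set.Icc u v, ∀ j, (∑ l, C (a j l) * X ^ (d l) : ℝ[X]).eval t ≠ 0)
    (hin : ∀ t ∈ Set.Icc u v, ∀ l, (l₀ < l ∧ l < l₁) ∨ (l₁ < l ∧ l < l₀) →
      0 ≤ ∑ j, a j l / (∑ l', C (a j l') * X ^ (d l') : ℝ[X]).eval t)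
    (hout : ∀ t ∈ Set.Icc u v, ∀ l, (l < l₀ ∧ l < l₁) ∨ (l₀ < l ∧ l₁ < l) →
      ∑ j, a j l / (∑ l', C (a j l') * X ^ (d l') : ℝ[X]).eval t ≤ 0)
    (hstrict : ∃ l, (((l₀ < l ∧ l < l₁) ∨ (l₁ < l ∧ l < l₀)) ∧
        ∀ t ∈ Set.Icc u v, 0 < ∑ j, a j l / (∑ l', C (a j l') * X ^ (d l') : ℝ[X]).eval t) ∨
      (((l < l₀ ∧ l < l₁) ∨ (l₀ < l ∧ l₁ < l)) ∧
        ∀ t ∈ Set.Icc u v, ∑ j, a j l / (∑ l', C (a j l') * X ^ (d l') : ℝ[X]).eval t < 0)) :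
    ((∑ j, (∑ l, C (a j l * ((d l : ℝ) - d l₀)) * X ^ (d l)) * ∏ i ∈ Finset.univ.erase j, (∑ l, C (a i l) * X ^ (d l))
        : ℝ[X]).roots.toFinset.filter (fun t => u ≤ t ∧ t ≤ v)).card ≤ 1 := by
  refine eulerNumerator_roots_Icc_le_one_of_indexFactor_sign d a l₀ l₁ hu hf ?_ ?_
  · intro t ht l
    -- position of `l` relative to `l₀`, `l₁`
    by_cases h0 : l = l₀
    · rw [h0, sub_self, zero_mul, zero_mul]
    by_cases h1 : l = l₁
    · rw [h1, sub_self, mul_zero, zero_mul]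
    rcases lt_or_gt_of_ne h0 with h0 | h0 <;> rcases lt_or_gt_of_ne h1 with h1 | h1
    · exact mul_nonpos_of_nonneg_of_nonpos (indexFactor_pos_of_outside d hd (Or.inl ⟨h0, h1⟩)).le (hout t ht l (Or.inl ⟨h0, h1⟩))
    · exact mul_nonpos_of_nonpos_of_nonneg (indexFactor_neg_of_between d hd (Or.inr ⟨h1, h0⟩)).le (hin t ht l (Or.inr ⟨h1, h0⟩))
    · exact mul_nonpos_of_nonpos_of_nonneg (indexFactor_neg_of_between d hd (Or.inl ⟨h0, h1⟩)).le (hin t ht l (Or.inl ⟨h0, h1⟩))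
    · exact mul_nonpos_of_nonneg_of_nonpos (indexFactor_pos_of_outside d hd (Or.inr ⟨h0, h1⟩)).le (hout t ht l (Or.inr ⟨h0, h1⟩))
  · intro t ht _
    obtain ⟨l, hl⟩ := hstrict
    refine ⟨l, ?_⟩
    rcases hl with ⟨hpos, hA⟩ | ⟨hpos, hA⟩
    · exact mul_neg_of_neg_of_pos (indexFactor_neg_of_between d hd hpos) (hA t ht)
    · exact mul_neg_of_pos_of_neg (indexFactor_pos_of_outside d hd hpos) (hA t ht)

/-- ★ **Adjacent pivot** (every K, every coupling): if `l₁` is a NEIGHBOUR of `l₀` (no letter strictly between them) the criterion reads: every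
other letter sum is `≤ 0` on the window and one of them is `< 0` ⇒ at most one zero.  (Bottom coupling, `l₁ = 1`: all `A_l`, `l ≥ 2`, non-positive —
the sign-free ✓ `…ABWindowK` «neg» chart with `≤` in place of `<` off one strict letter; TOP coupling, `l₁ = K−2`: all `A_l`, `l ≤ K−3`, non-positive.)
[this file's theorem] -/
theorem eulerNumerator_roots_Icc_le_one_of_letterSigns_adjacent {m K : ℕ} (d : Fin K → ℕ) (hd : StrictMono d)
    (a : Fin m → Fin K → ℝ) (l₀ l₁ : Fin K) (hadj : ∀ l, ¬ ((l₀ < l ∧ l < l₁) ∨ (l₁ < l ∧ l < l₀)))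
    {u v : ℝ} (hu : 0 < u) (hf : ∀ t ∈ Set.Icc u v, ∀ j, (∑ l, C (a j l) * X ^ (d l) : ℝ[X]).eval t ≠ 0)
    (hout : ∀ t ∈ Set.Icc u v, ∀ l, l ≠ l₀ → l ≠ l₁ → ∑ j, a j l / (∑ l', C (a j l') * X ^ (d l') : ℝ[X]).eval t ≤ 0)
    (hstrict : ∃ l, l ≠ l₀ ∧ l ≠ l₁ ∧ ∀ t ∈ Set.Icc u v, ∑ j, a j l / (∑ l', C (a j l') * X ^ (d l') : ℝ[X]).eval t < 0) :
    ((∑ j, (∑ l, C (a j l * ((d l : ℝ) - d l₀)) * X ^ (d l)) * ∏ i ∈ Finset.univ.erase j, (∑ l, C (a i l) * X ^ (d l))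
        : ℝ[X]).roots.toFinset.filter (fun t => u ≤ t ∧ t ≤ v)).card ≤ 1 := by
  have hside : ∀ l, l ≠ l₀ → l ≠ l₁ → (l < l₀ ∧ l < l₁) ∨ (l₀ < l ∧ l₁ < l) := by
    intro l h0 h1
    rcases lt_or_gt_of_ne h0 with h0' | h0' <;> rcases lt_or_gt_of_ne h1 with h1' | h1'
    · exact Or.inl ⟨h0', h1'⟩
    · exact absurd (Or.inr ⟨h1', h0'⟩) (hadj l)
    · exact absurd (Or.inl ⟨h0', h1'⟩) (hadj l)
    · exact Or.inr ⟨h0', h1'⟩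
  refine eulerNumerator_roots_Icc_le_one_of_letterSigns d hd a l₀ l₁ hu hf (fun t _ l hl => absurd hl (hadj l))
    (fun t ht l hl => hout t ht l ?_ ?_) ?_
  · rintro rfl; rcases hl with ⟨h, _⟩ | ⟨h, _⟩ <;> exact lt_irrefl _ h
  · rintro rfl; rcases hl with ⟨_, h⟩ | ⟨_, h⟩ <;> exact lt_irrefl _ h
  · obtain ⟨l, h0, h1, hA⟩ := hstrict
    exact ⟨l, Or.inr ⟨hside l h0 h1, hA⟩⟩

/-- ★ **Far pivot at the TOP coupling** (every `K ≥ 3`; new chart): coupling `l₀ = K−1`, pivot `l₁ = 0`: if every MIDDLE letter sum `A_l`,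
`0 < l < K−1`, is `≥ 0` on the window and one of them is `> 0`, then `eulerNumerator d a ⟨K−1,_⟩` has at most one zero there — the top-coupling
mirror of ✓ `eulerNumeratorK_roots_Icc_le_one_of_letterSums_pos(_signfree)`, for EVERY company. [this file's theorem] -/
theorem eulerNumeratorTopK_roots_Icc_le_one_of_middle_letterSums_nonneg {m K : ℕ} (hK : 3 ≤ K) (d : Fin K → ℕ) (hd : StrictMono d)
    (a : Fin m → Fin K → ℝ) {u v : ℝ} (hu : 0 < u)
    (hf : ∀ t ∈ Set.Icc u v, ∀ j, (∑ l, C (a j l) * X ^ (d l) : ℝ[X]).eval t ≠ 0)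
    (hmid : ∀ t ∈ Set.Icc u v, ∀ l : Fin K, 0 < (l : ℕ) → (l : ℕ) < K - 1 →
      0 ≤ ∑ j, a j l / (∑ l', C (a j l') * X ^ (d l') : ℝ[X]).eval t)
    (hstrict : ∃ l : Fin K, 0 < (l : ℕ) ∧ (l : ℕ) < K - 1 ∧
      ∀ t ∈ Set.Icc u v, 0 < ∑ j, a j l / (∑ l', C (a j l') * X ^ (d l') : ℝ[X]).eval t) :
    ((∑ j, (∑ l, C (a j l * ((d l : ℝ) - d ⟨K - 1, by omega⟩)) * X ^ (d l)) * ∏ i ∈ Finset.univ.erase j,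
        (∑ l, C (a i l) * X ^ (d l)) : ℝ[X]).roots.toFinset.filter (fun t => u ≤ t ∧ t ≤ v)).card ≤ 1 := by
  refine eulerNumerator_roots_Icc_le_one_of_letterSigns d hd a ⟨K - 1, by omega⟩ ⟨0, by omega⟩ hu hf ?_ ?_ ?_
  · intro t ht l hl
    rcases hl with ⟨h, _⟩ | ⟨h0, h1⟩
    · exact absurd (Fin.lt_def.mp h) (by have := l.isLt; simp; omega)
    · exact hmid t ht l (by simpa [Fin.lt_def] using h0) (by simpa [Fin.lt_def] using h1)
  · intro t ht l hl
    rcases hl with ⟨_, h⟩ | ⟨h, _⟩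
    · exact absurd (Fin.lt_def.mp h) (by simp)
    · exact absurd (Fin.lt_def.mp h) (by have := l.isLt; simp; omega)
  · obtain ⟨l, h0, h1, hA⟩ := hstrict
    exact ⟨l, Or.inl ⟨Or.inr ⟨Fin.lt_def.mpr (by simpa using h0), Fin.lt_def.mpr (by simpa using h1)⟩, hA⟩⟩

/-! ### §3 Every K, every coupling: VARIANCE windows (AB6-1 as a window count) -/

/-- At a zero `t` of `R = eulerNumerator d a l₀` off the poles, EVERY centred second moment dominates the `κ = 0` reduced moment:
`Σ_l e_l²·t^{d_l}·A_l(t) ≤ Σ_l (d_l − c)²·t^{d_l}·A_l(t)` (`e_l = d_l − d_{l₀}`; the difference is `(c − d_{l₀})²·m ≥ 0` because the first moment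
vanishes and `Σ_l t^{d_l}A_l(t) = m`). [this file's theorem] -/
theorem reducedMoment_zero_le_centredMoment_at_root {m K : ℕ} (d : Fin K → ℕ) (a : Fin m → Fin K → ℝ) (l₀ : Fin K) (c t : ℝ)
    (hf : ∀ j, (∑ l, C (a j l) * X ^ (d l) : ℝ[X]).eval t ≠ 0)
    (hRt : (∑ j, (∑ l, C (a j l * ((d l : ℝ) - d l₀)) * X ^ (d l)) * ∏ i ∈ Finset.univ.erase j, (∑ l, C (a i l) * X ^ (d l))
        : ℝ[X]).eval t = 0) :
    ∑ l, ((d l : ℝ) - d l₀) * (((d l : ℝ) - d l₀) - 0) * t ^ (d l) * ∑ j, a j l / (∑ l', C (a j l') * X ^ (d l') : ℝ[X]).eval t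
      ≤ ∑ l, ((d l : ℝ) - c) ^ 2 * t ^ (d l) * ∑ j, a j l / (∑ l', C (a j l') * X ^ (d l') : ℝ[X]).eval t := by
  classical
  have hP : (∏ j, (∑ l, C (a j l) * X ^ (d l) : ℝ[X]).eval t) ≠ 0 := Finset.prod_ne_zero_iff.2 fun j _ => hf j
  -- first moment = 0, zeroth moment = m
  have hM1 : ∑ l, ((d l : ℝ) - d l₀) * t ^ (d l) * ∑ j, a j l / (∑ l', C (a j l') * X ^ (d l') : ℝ[X]).eval t = 0 := by
    have h := eval_eulerNumerator_eq_prod_mul_letterSumsK d a l₀ hf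
    rw [hRt] at h
    exact (mul_eq_zero.mp h.symm).resolve_left hP
  have hM0 : ∑ l, t ^ (d l) * ∑ j, a j l / (∑ l', C (a j l') * X ^ (d l') : ℝ[X]).eval t = m := by
    have hrow : ∀ j, ∑ l, t ^ (d l) * (a j l / (∑ l', C (a j l') * X ^ (d l') : ℝ[X]).eval t) = 1 := by
      intro j
      have hfj := hf j
      rw [eval_fewnomial] at hfj
      simp only [eval_fewnomial, ← mul_div_assoc]
      rw [← Finset.sum_div]
      have : ∑ l, t ^ (d l) * a j l = ∑ l, a j l * t ^ (d l) := Finset.sum_congr rfl fun l _ => mul_comm _ _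
      rw [this, div_self hfj]
    simp only [Finset.mul_sum]
    rw [Finset.sum_comm]
    simp only [hrow, Finset.sum_const, Finset.card_univ, Fintype.card_fin, nsmul_eq_mul, mul_one]
  have key : ∑ l, ((d l : ℝ) - c) ^ 2 * t ^ (d l) * ∑ j, a j l / (∑ l', C (a j l') * X ^ (d l') : ℝ[X]).eval t
      = ∑ l, ((d l : ℝ) - d l₀) * (((d l : ℝ) - d l₀) - 0) * t ^ (d l) * ∑ j, a j l / (∑ l', C (a j l') * X ^ (d l') : ℝ[X]).eval t
        - 2 * (c - d l₀) * ∑ l, ((d l : ℝ) - d l₀) * t ^ (d l) * ∑ j, a j l / (∑ l', C (a j l') * X ^ (d l') : ℝ[X]).eval t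
        + (c - d l₀) ^ 2 * ∑ l, t ^ (d l) * ∑ j, a j l / (∑ l', C (a j l') * X ^ (d l') : ℝ[X]).eval t := by
    rw [Finset.mul_sum, Finset.mul_sum, ← Finset.sum_sub_distrib, ← Finset.sum_add_distrib]
    exact Finset.sum_congr rfl fun l _ => by ring
  rw [key, hM1, hM0, mul_zero, sub_zero]
  nlinarith [sq_nonneg (c - (d l₀ : ℝ))]

/-- ★ **VARIANCE WINDOWS (val-idea-25 AB6-1 as a count; every K, EVERY coupling at once, no row-sign hypothesis):** if at every zero of
`R = eulerNumerator d a l₀` in a pole-free `[u,v] ⊂ (0,∞)` SOME centred second letter moment `Σ_l (d_l − c)²·t^{d_l}·A_l(t)` is negative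
(`Var_A(d) < 0`: the total Euler ratio `F` is strictly decreasing there), then `R` has AT MOST ONE zero in `[u,v]` — for every `l₀`.
[this file's theorem; val-idea-25 AB6-1] -/
theorem eulerNumerator_roots_Icc_le_one_of_centredMoment_neg {m K : ℕ} (d : Fin K → ℕ) (a : Fin m → Fin K → ℝ) (l₀ : Fin K)
    {u v : ℝ} (hu : 0 < u) (hf : ∀ t ∈ Set.Icc u v, ∀ j, (∑ l, C (a j l) * X ^ (d l) : ℝ[X]).eval t ≠ 0)
    (hvar : ∀ t ∈ Set.Icc u v,
      (∑ j, (∑ l, C (a j l * ((d l : ℝ) - d l₀)) * X ^ (d l)) * ∏ i ∈ Finset.univ.erase j, (∑ l, C (a i l) * X ^ (d l))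
          : ℝ[X]).eval t = 0 →
        ∃ c : ℝ, ∑ l, ((d l : ℝ) - c) ^ 2 * t ^ (d l) * ∑ j, a j l / (∑ l', C (a j l') * X ^ (d l') : ℝ[X]).eval t < 0) :
    ((∑ j, (∑ l, C (a j l * ((d l : ℝ) - d l₀)) * X ^ (d l)) * ∏ i ∈ Finset.univ.erase j, (∑ l, C (a i l) * X ^ (d l))
        : ℝ[X]).roots.toFinset.filter (fun t => u ≤ t ∧ t ≤ v)).card ≤ 1 := by
  refine eulerNumerator_roots_Icc_le_one_of_reducedMoment_neg d a l₀ hu hf fun t ht hRt => ⟨0, ?_⟩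
  obtain ⟨c, hc⟩ := hvar t ht hRt
  exact (reducedMoment_zero_le_centredMoment_at_root d a l₀ c t (hf t ht) hRt).trans_lt hc

end ProductPlusOne

end Summit.ValiantsHypothesis.ValiantsHypothesis.Theorems.LacunarySymmetroidMatrixDescartes
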